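import Literature.InformationTheory.QuantumCodes.ToricCodeThreshold
import Mathlib.Algebra.BigOperators.Intervals
import HarnessLib

/-!
# Homologically non-trivial cycles of the toric code have at least `L` links
# (`ToricCode.cycle_weight_ge` discharged)

Topic `Literature/InformationTheory/QuantumCodes` (venture QEC, LADDER-QEC rung Q5). Theorem-only
companion of `ToricCodeThreshold.lean` (qec-type-09), whose named fact

  `ToricCode.cycle_weight_ge : ∀ L [NeZero L] (z : Chain L), z ∈ cycles L → z ∉ boundaries L → L ≤ |z|`

("At a minimum, the homologically nontrivial (self-avoiding) path must contain at least `L`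
links", Dennis–Kitaev–Landahl–Preskill 2002 §5.2; i.e. `d_Z ≥ L` for the `L × L` toric code) is
PROVED here as `ToricCode.cycle_weight_ge_holds`.

**Proof** (the standard cut-open-torus argument, written in integer coordinates). Let `z` be a
cycle (`H^X z = 0`: at every site the four incident links carry an even number of errors) with
fewer than `L` links. By pigeonhole some column `a₀ ∈ ℤ_L` and some row `b₀ ∈ ℤ_L` carry no link
of `z` at all (`exists_empty_coord`, pigeonhole); translating the torus
(`translate`, which preserves cycles, boundaries and the weight) we may take `a₀ = b₀ = -1`. In
integer coordinates `0 ≤ j, k ≤ n = L - 1` define the 2-chain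
`C(j,k) = Σ_{j < j' ≤ n} z((j',k), vertical)` — the parity of the vertical links of `z` to the
right of the plaquette `(j,k)` in its row (`twoChain`). Then `∂C = z`:
* on a vertical link `((j,k),1)`, `C(j,k) + C(j-1,k) = z((j,k),1)` for `j ≥ 1` by telescoping,
  and for `j = 0` because the total number of vertical links of a cycle in any row of links is
  even (`rowSum_eq_zero`: it is the same in every row by the star condition summed over a row of
  sites, and zero in the empty row);
* on a horizontal link `((j,k),0)`, `C(j,k) + C(j,k-1) = Σ_{j' > j} [z((j',k),1) + z((j',k-1),1)]
  = Σ_{j' > j} [z((j',k),0) + z((j'-1,k),0)]` (star condition at the sites `(j',k)`), which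
  telescopes to `z((j,k),0) + z((n,k),0) = z((j,k),0)` (empty column).
Hence `z` is a boundary. The argument is uniform in `L ≥ 1` (for `L = 1` every chain with an
empty row is zero).

## References

* [DennisEtAl2002] E. Dennis, A. Kitaev, A. Landahl, J. Preskill, *Topological quantum memory*,
  J. Math. Phys. 43 (2002) 4452–4505, arXiv:quant-ph/0110143, §3.1 (the torus cell complex:
  "a homologically nontrivial cycle … must wind around the torus"), §5.2 ("at least `L` links").
* [Kitaev2003] A. Yu. Kitaev, *Fault-tolerant quantum computation by anyons*, Ann. Phys. 303
  (2003) 2–30, §2 (the code distance of the toric code is the lattice size) — cited through DKLP.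
-/

namespace Literature.InformationTheory.QuantumCodes

namespace ToricCode

open Finset Matrix
open Literature.Probability.LatticeModels (TorusSite)

variable {L : ℕ}

/-! ### Unfolding the check matrices -/

/-- The star syndrome at a site is the sum of the four incident link values:
`(H^X z)_s = z(s,0) + z(s,1) + z(s-e₀,0) + z(s-e₁,1)`. [cite: DennisEtAl2002, §3.1 (X_s = ⊗_{ℓ ∋ s} X_ℓ)] -/
theorem starMatrix_mulVec_apply [NeZero L] (z : Chain L) (s : Vertex L) :
    (starMatrix L *ᵥ z) s = z (s, 0) + z (s, 1) + z (s - dir 0, 0) + z (s - dir 1, 1) := by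
  change starRow s ⬝ᵥ z = _
  simp only [starRow, add_dotProduct, single_dotProduct, one_mul]

/-- The boundary of a 2-chain `c` on a horizontal link `(u,0)`: the plaquettes `u` (below… i.e.
with lower-left corner `u`) and `u - e₁` are the two plaquettes containing it,
`(cᵀ H^Z)_{(u,0)} = c(u) + c(u - e₁)`. [cite: DennisEtAl2002, §3.1 (Z_P = ⊗_{ℓ ∈ P} Z_ℓ)] -/
theorem vecMul_plaquetteMatrix_fst [NeZero L] (c : Vertex L → ZMod 2) (u : Vertex L) :
    (c ᵥ* plaquetteMatrix L) (u, 0) = c u + c (u - dir 1) := by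
  simp only [Matrix.vecMul, dotProduct, plaquetteMatrix, Matrix.of_apply, plaquetteRow,
    Pi.add_apply, Pi.single_apply, Prod.mk.injEq]
  simp only [Fin.isValue, and_true, zero_ne_one, and_false, if_false, add_zero]
  simp only [mul_add, Finset.sum_add_distrib, mul_ite, mul_one, mul_zero]
  have h1 : ∀ w : Vertex L, (u = w + dir 1) ↔ (u - dir 1 = w) := fun w => by
    rw [sub_eq_iff_eq_add]
  simp only [h1, Finset.sum_ite_eq, Finset.mem_univ, if_true]

/-- The boundary of a 2-chain `c` on a vertical link `(u,1)`: the plaquettes `u` and `u - e₀`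
contain it, `(cᵀ H^Z)_{(u,1)} = c(u) + c(u - e₀)`. [cite: DennisEtAl2002, §3.1 (Z_P = ⊗_{ℓ ∈ P} Z_ℓ)] -/
theorem vecMul_plaquetteMatrix_snd [NeZero L] (c : Vertex L → ZMod 2) (u : Vertex L) :
    (c ᵥ* plaquetteMatrix L) (u, 1) = c u + c (u - dir 0) := by
  simp only [Matrix.vecMul, dotProduct, plaquetteMatrix, Matrix.of_apply, plaquetteRow,
    Pi.add_apply, Pi.single_apply, Prod.mk.injEq]
  simp only [Fin.isValue, and_true, one_ne_zero, and_false, if_false, add_zero, zero_add]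
  simp only [mul_add, Finset.sum_add_distrib, mul_ite, mul_one, mul_zero]
  have h1 : ∀ w : Vertex L, (u = w + dir 0) ↔ (u - dir 0 = w) := fun w => by
    rw [sub_eq_iff_eq_add]
  simp only [h1, Finset.sum_ite_eq, Finset.mem_univ, if_true]

/-- A chain is a boundary as soon as some 2-chain `c` has `cᵀ H^Z` agreeing with it on every
horizontal and every vertical link. [cite: DennisEtAl2002, §4.3 (homologically trivial = boundary of a surface)] -/
theorem mem_boundaries_of_twoChain [NeZero L] {z : Chain L} (c : Vertex L → ZMod 2)
    (h0 : ∀ u, c u + c (u - dir 1) = z (u, 0)) (h1 : ∀ u, c u + c (u - dir 0) = z (u, 1)) :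
    z ∈ boundaries L := by
  change z ∈ rowSpace (plaquetteMatrix L)
  refine mem_rowSpace_of_vecMul_eq c (funext fun ℓ => ?_)
  obtain ⟨u, i⟩ := ℓ
  fin_cases i
  · simpa [vecMul_plaquetteMatrix_fst] using h0 u
  · simpa [vecMul_plaquetteMatrix_snd] using h1 u

/-! ### Translating the torus -/

/-- Translation of a 1-chain by a lattice vector `t`: `(τ_t z)(v,i) = z(v + t, i)`. [folklore] -/
private def translate (t : Vertex L) (z : Chain L) : Chain L := fun ℓ => z (ℓ.1 + t, ℓ.2)

/-- Translation preserves cycles (the star condition is translation invariant).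
[cite: DennisEtAl2002, §3.1 (translation-invariant lattice)] -/
private theorem syn_translate_eq_zero [NeZero L] (t : Vertex L) {z : Chain L} (hz : syn L z = 0) :
    syn L (translate t z) = 0 := by
  funext s
  have h := congrFun hz (s + t)
  rw [Pi.zero_apply] at h ⊢
  unfold syn at h ⊢
  rw [starMatrix_mulVec_apply] at h ⊢
  simp only [translate]
  have e0 : s - dir 0 + t = s + t - dir 0 := by abel
  have e1 : s - dir 1 + t = s + t - dir 1 := by abel
  rw [e0, e1]
  exact h

/-- If a translate of `z` is a boundary then so is `z`. [cite: DennisEtAl2002, §3.1 (translation-invariant lattice)] -/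
private theorem mem_boundaries_of_translate [NeZero L] (t : Vertex L) {z : Chain L}
    (c' : Vertex L → ZMod 2)
    (h0 : ∀ u, c' u + c' (u - dir 1) = translate t z (u, 0))
    (h1 : ∀ u, c' u + c' (u - dir 0) = translate t z (u, 1)) : z ∈ boundaries L := by
  refine mem_boundaries_of_twoChain (fun w => c' (w - t)) (fun u => ?_) (fun u => ?_)
  · have h := h0 (u - t)
    simp only [translate, sub_add_cancel] at h
    have e : u - dir 1 - t = u - t - dir 1 := by abel
    rw [e]
    exact h
  · have h := h1 (u - t)
    simp only [translate, sub_add_cancel] at h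
    have e : u - dir 0 - t = u - t - dir 0 := by abel
    rw [e]
    exact h

/-! ### Empty rows and columns by pigeonhole -/

/-- A chain with fewer than `L` links misses some column entirely: no link `(v,i)` of `z` has
`v₀ = a₀`. [cite: DennisEtAl2002, §5.2 (fewer than L links cannot wind around the torus)] -/
private theorem exists_empty_coord [NeZero L] (z : Chain L) (hw : hammingNorm z < L) (i₀ : Fin 2) :
    ∃ a₀ : ZMod L, ∀ (v : Vertex L) (i : Fin 2), v i₀ = a₀ → z (v, i) = 0 := by
  classical
  set S : Finset (Edge L) := univ.filter fun ℓ => z ℓ ≠ 0 with hS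
  have hcard : S.card = hammingNorm z := rfl
  set f : Edge L → ZMod L := fun ℓ => ℓ.1 i₀ with hf
  have hlt : (S.image f).card < (univ : Finset (ZMod L)).card := by
    calc (S.image f).card ≤ S.card := Finset.card_image_le
      _ < L := by rw [hcard]; exact hw
      _ = (univ : Finset (ZMod L)).card := by rw [Finset.card_univ, ZMod.card]
  have hne : S.image f ≠ univ := fun h => by rw [h] at hlt; exact lt_irrefl _ hlt
  obtain ⟨a₀, -, ha₀⟩ := Finset.exists_mem_notMem_of_card_lt_card hlt
  refine ⟨a₀, fun v i hv => ?_⟩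
  by_contra hzv
  refine ha₀ (Finset.mem_image.2 ⟨(v, i), ?_, hv⟩)
  rw [hS, Finset.mem_filter]
  exact ⟨Finset.mem_univ _, hzv⟩

/-! ### Integer coordinates -/

/-- The site with integer coordinates `(j, k)` (mod `L`). [folklore] -/
private def vtx (j k : ℕ) : Vertex L := ![(j : ZMod L), (k : ZMod L)]

/-- First coordinate of `vtx j k`. [folklore] -/
private theorem vtx_apply_zero (j k : ℕ) : (vtx j k : Vertex L) 0 = (j : ZMod L) := by
  simp [vtx]

/-- Second coordinate of `vtx j k`. [folklore] -/
private theorem vtx_apply_one (j k : ℕ) : (vtx j k : Vertex L) 1 = (k : ZMod L) := by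
  simp [vtx]

/-- `vtx` is `L`-periodic in the first coordinate. [folklore] -/
private theorem vtx_add_left (j k : ℕ) : (vtx (j + L) k : Vertex L) = vtx j k := by
  ext i; fin_cases i <;> simp [vtx]

/-- `vtx` is `L`-periodic in the second coordinate. [folklore] -/
private theorem vtx_add_right (j k : ℕ) : (vtx j (k + L) : Vertex L) = vtx j k := by
  ext i; fin_cases i <;> simp [vtx]

/-- One step to the right: `vtx (j+1) k = vtx j k + e₀`. [folklore] -/
private theorem vtx_succ_left (j k : ℕ) : (vtx (j + 1) k : Vertex L) = vtx j k + dir 0 := by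
  ext i; fin_cases i <;> simp [vtx, dir]

/-- One step up: `vtx j (k+1) = vtx j k + e₁`. [folklore] -/
private theorem vtx_succ_right (j k : ℕ) : (vtx j (k + 1) : Vertex L) = vtx j k + dir 1 := by
  ext i; fin_cases i <;> simp [vtx, dir]

/-- Every site has integer coordinates (the canonical representatives). [folklore] -/
private theorem eq_vtx [NeZero L] (v : Vertex L) : v = vtx (v 0).val (v 1).val := by
  ext i; fin_cases i <;> simp [vtx]

/-- Horizontal link values in integer coordinates: `Z0 z j k = z((j,k), 0)`. [folklore] -/
private def Z0 (z : Chain L) (j k : ℕ) : ZMod 2 := z (vtx j k, 0)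

/-- Vertical link values in integer coordinates: `Z1 z j k = z((j,k), 1)`. [folklore] -/
private def Z1 (z : Chain L) (j k : ℕ) : ZMod 2 := z (vtx j k, 1)

/-- Periodicity of the horizontal link values (first coordinate). [folklore] -/
private theorem Z0_add_left (z : Chain L) (j k : ℕ) : Z0 z (j + L) k = Z0 z j k := by
  simp [Z0, vtx_add_left]

/-- Periodicity of the horizontal link values (second coordinate). [folklore] -/
private theorem Z0_add_right (z : Chain L) (j k : ℕ) : Z0 z j (k + L) = Z0 z j k := by
  simp [Z0, vtx_add_right]

/-- Periodicity of the vertical link values (first coordinate). [folklore] -/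
private theorem Z1_add_left (z : Chain L) (j k : ℕ) : Z1 z (j + L) k = Z1 z j k := by
  simp [Z1, vtx_add_left]

/-- Periodicity of the vertical link values (second coordinate). [folklore] -/
private theorem Z1_add_right (z : Chain L) (j k : ℕ) : Z1 z j (k + L) = Z1 z j k := by
  simp [Z1, vtx_add_right]

/-- The star condition in integer coordinates, at the site `(j+1, k+1)`.
[cite: DennisEtAl2002, §4.3 (a cycle has no boundary)] -/
private theorem star_nat [NeZero L] {z : Chain L} (hz : syn L z = 0) (j k : ℕ) :
    Z0 z (j + 1) (k + 1) + Z1 z (j + 1) (k + 1) + Z0 z j (k + 1) + Z1 z (j + 1) k = 0 := by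
  have h := congrFun hz (vtx (j + 1) (k + 1))
  rw [Pi.zero_apply] at h
  unfold syn at h
  rw [starMatrix_mulVec_apply] at h
  have e0 : (vtx (j + 1) (k + 1) : Vertex L) - dir 0 = vtx j (k + 1) := by
    rw [vtx_succ_left, add_sub_cancel_right]
  have e1 : (vtx (j + 1) (k + 1) : Vertex L) - dir 1 = vtx (j + 1) k := by
    rw [vtx_succ_right, add_sub_cancel_right]
  rw [e0, e1] at h
  exact h

/-! ### Arithmetic in `ℤ₂` -/

/-- `x + x = 0` in `ℤ₂`. [folklore] -/
private theorem zmod2_add_self (x : ZMod 2) : x + x = 0 := by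
  revert x; decide

/-- `x + y = 0 → x = y` in `ℤ₂`. [folklore] -/
private theorem zmod2_eq_of_add_eq_zero {x y : ZMod 2} (h : x + y = 0) : x = y := by
  revert x y; decide

/-- `a + b + c + d = 0 → b + d = a + c` in `ℤ₂`. [folklore] -/
private theorem zmod2_bd_eq_ac {a b c d : ZMod 2} (h : a + b + c + d = 0) : b + d = a + c := by
  revert a b c d; decide

/-- Telescoping in `ℤ₂`: `Σ_{i<m} (f(i+1) + f(i)) = f(m) + f(0)`. [folklore] -/
private theorem zmod2_telescope (f : ℕ → ZMod 2) (m : ℕ) :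
    ∑ i ∈ range m, (f (i + 1) + f i) = f m + f 0 := by
  induction m with
  | zero => simp [zmod2_add_self]
  | succ m ih =>
    rw [Finset.sum_range_succ, ih]
    have := zmod2_add_self (f m)
    -- f m + f 0 + (f (m+1) + f m) = f (m+1) + f 0
    calc f m + f 0 + (f (m + 1) + f m) = f (m + 1) + f 0 + (f m + f m) := by ring
      _ = f (m + 1) + f 0 := by rw [this, add_zero]

/-- A shift by one step of a sum over a full period of a periodic sequence. [folklore] -/
private theorem sum_range_succ_shift {M : Type*} [AddCommMonoid M] [IsCancelAdd M] (f : ℕ → M)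
    (N : ℕ) (hf : f N = f 0) : ∑ i ∈ range N, f (i + 1) = ∑ i ∈ range N, f i := by
  have h1 := Finset.sum_range_succ' f N
  have h2 := Finset.sum_range_succ f N
  rw [hf] at h2
  exact add_right_cancel (h1.symm.trans h2)

/-! ### The row sums of a cycle vanish -/

/-- The number (mod 2) of vertical links of `z` in the row of links `k`:
`R(k) = Σ_{i<L} z((i,k),1)`. [folklore] -/
private def rowSum (z : Chain L) (k : ℕ) : ZMod 2 := ∑ i ∈ range L, Z1 z i k

/-- For a cycle, consecutive row sums agree (star condition summed over a row of sites; the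
horizontal links cancel in pairs). [cite: DennisEtAl2002, §4.3 (cycles)] -/
private theorem rowSum_succ [NeZero L] {z : Chain L} (hz : syn L z = 0) (k : ℕ) :
    rowSum z (k + 1) = rowSum z k := by
  have hsum : ∑ i ∈ range L,
      (Z0 z (i + 1) (k + 1) + Z1 z (i + 1) (k + 1) + Z0 z i (k + 1) + Z1 z (i + 1) k) = 0 :=
    Finset.sum_eq_zero fun i _ => star_nat hz i k
  simp only [Finset.sum_add_distrib] at hsum
  rw [sum_range_succ_shift (fun i => Z0 z i (k + 1)) L (by simpa using Z0_add_left z 0 (k + 1)),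
    sum_range_succ_shift (fun i => Z1 z i (k + 1)) L (by simpa using Z1_add_left z 0 (k + 1)),
    sum_range_succ_shift (fun i => Z1 z i k) L (by simpa using Z1_add_left z 0 k)] at hsum
  -- hsum : S + R(k+1) + S + R(k) = 0
  refine zmod2_eq_of_add_eq_zero ?_
  unfold rowSum
  have hS := zmod2_add_self (∑ i ∈ range L, Z0 z i (k + 1))
  calc ∑ i ∈ range L, Z1 z i (k + 1) + ∑ i ∈ range L, Z1 z i k
      = (∑ i ∈ range L, Z0 z i (k + 1) + ∑ i ∈ range L, Z0 z i (k + 1)) +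
          (∑ i ∈ range L, Z1 z i (k + 1) + ∑ i ∈ range L, Z1 z i k) := by rw [hS, zero_add]
    _ = ∑ i ∈ range L, Z0 z i (k + 1) + ∑ i ∈ range L, Z1 z i (k + 1) +
          ∑ i ∈ range L, Z0 z i (k + 1) + ∑ i ∈ range L, Z1 z i k := by ring
    _ = 0 := hsum

/-- For a cycle with an empty row of links `n`, every row sum vanishes: the vertical links of a
cycle cross every horizontal dual loop an even number of times.
[cite: DennisEtAl2002, §4.3 (cycles)] -/
private theorem rowSum_eq_zero [NeZero L] {z : Chain L} (hz : syn L z = 0) {n : ℕ}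
    (hrow : ∀ i, Z1 z i n = 0)
    (k : ℕ) : rowSum z k = 0 := by
  have hconst : ∀ k, rowSum z k = rowSum z 0 := by
    intro k
    induction k with
    | zero => rfl
    | succ k ih => rw [rowSum_succ hz, ih]
  have hn : rowSum z n = 0 := Finset.sum_eq_zero fun i _ => hrow i
  rw [hconst k, ← hconst n, hn]

/-! ### The bounding 2-chain -/

/-- The 2-chain `C(j,k) = Σ_{j < j' ≤ n} z((j',k),1)`: parity of the vertical links of `z` to the
right of the plaquette `(j,k)` in its row, up to the last column `n = L-1`. [folklore] -/
private def twoChain (z : Chain L) (n j k : ℕ) : ZMod 2 := ∑ i ∈ range (n - j), Z1 z (j + i + 1) k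

/-- The 2-chain vanishes from the last column on. [folklore] -/
private theorem twoChain_of_le (z : Chain L) {n j : ℕ} (h : n ≤ j) (k : ℕ) : twoChain z n j k = 0 := by
  simp [twoChain, Nat.sub_eq_zero_of_le h]

/-- The 2-chain is `L`-periodic in the row index. [folklore] -/
private theorem twoChain_add_right (z : Chain L) (n j k : ℕ) :
    twoChain z n j (k + L) = twoChain z n j k := by
  simp [twoChain, Z1_add_right]

/-- Peeling the first vertical link: `C(j,k) = z((j+1,k),1) + C(j+1,k)` for `j < n`. [folklore] -/
private theorem twoChain_step (z : Chain L) {n j : ℕ} (h : j < n) (k : ℕ) :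
    twoChain z n j k = Z1 z (j + 1) k + twoChain z n (j + 1) k := by
  unfold twoChain
  obtain ⟨m, hm⟩ : ∃ m, n - j = m + 1 := ⟨n - j - 1, by omega⟩
  have hm' : n - (j + 1) = m := by omega
  rw [hm, hm', Finset.sum_range_succ', add_comm]
  have e : ∀ i, j + (i + 1) + 1 = j + 1 + i + 1 := fun i => by omega
  simp only [e, add_zero]

/-- **Vertical links, `j ≥ 1`**: `C(j+1,k) + C(j,k) = z((j+1,k),1)` for `j < n` (telescoping).
[cite: DennisEtAl2002, §3.1 (∂ of a 2-chain)] -/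
private theorem twoChain_vert {z : Chain L} {n j : ℕ} (h : j < n) (k : ℕ) :
    twoChain z n (j + 1) k + twoChain z n j k = Z1 z (j + 1) k := by
  rw [twoChain_step z h k]
  have := zmod2_add_self (twoChain z n (j + 1) k)
  calc twoChain z n (j + 1) k + (Z1 z (j + 1) k + twoChain z n (j + 1) k)
      = Z1 z (j + 1) k + (twoChain z n (j + 1) k + twoChain z n (j + 1) k) := by ring
    _ = Z1 z (j + 1) k := by rw [this, add_zero]

/-- **Vertical links, `j = 0`** (`L = n+1`): `C(0,k) + C(n,k) = z((0,k),1)`, because `C(n,k) = 0`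
and `C(0,k) + z((0,k),1)` is the row sum, which vanishes. [cite: DennisEtAl2002, §3.1 (∂ of a 2-chain)] -/
private theorem twoChain_vert_zero {n : ℕ} {z : Chain (n + 1)} (hz : syn (n + 1) z = 0)
    (hrow : ∀ i, Z1 z i n = 0) (k : ℕ) :
    twoChain z n 0 k + twoChain z n n k = Z1 z 0 k := by
  rw [twoChain_of_le z le_rfl k, add_zero]
  have hR := rowSum_eq_zero hz hrow k
  unfold rowSum at hR
  rw [Finset.sum_range_succ'] at hR
  -- hR : Σ_{i<n} Z1 (i+1) k + Z1 0 k = 0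
  have hC : twoChain z n 0 k = ∑ i ∈ range n, Z1 z (i + 1) k := by
    unfold twoChain
    rw [Nat.sub_zero]
    refine Finset.sum_congr rfl fun i _ => ?_
    rw [zero_add]
  rw [hC]
  exact zmod2_eq_of_add_eq_zero hR

/-- **Horizontal links**: `C(j,k+1) + C(j,k) = z((j,k+1),0)` for `j ≤ n`, given the empty column
`n` (star condition at the sites `(j',k+1)`, `j' > j`, then telescoping along the row).
[cite: DennisEtAl2002, §3.1 (∂ of a 2-chain)] -/
private theorem twoChain_horiz [NeZero L] {z : Chain L} (hz : syn L z = 0) {n j : ℕ} (hj : j ≤ n)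
    (hcol : ∀ k, Z0 z n k = 0) (k : ℕ) :
    twoChain z n j (k + 1) + twoChain z n j k = Z0 z j (k + 1) := by
  unfold twoChain
  rw [← Finset.sum_add_distrib]
  have hstar : ∀ i ∈ range (n - j),
      Z1 z (j + i + 1) (k + 1) + Z1 z (j + i + 1) k = Z0 z (j + i + 1) (k + 1) + Z0 z (j + i) (k + 1) :=
    fun i _ => zmod2_bd_eq_ac (star_nat hz (j + i) k)
  rw [Finset.sum_congr rfl hstar]
  have htel := zmod2_telescope (fun i => Z0 z (j + i) (k + 1)) (n - j)
  simp only [add_zero] at htel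
  have e : ∀ i, j + (i + 1) = j + i + 1 := fun i => by omega
  simp only [e] at htel
  rw [htel, show j + (n - j) = n by omega, hcol, zero_add]

/-! ### Assembly -/

/-- **Core lemma**: a cycle with no HORIZONTAL link in the column `-1` and no VERTICAL link in the
row `-1` is a boundary (it lives on the torus cut open along two dual loops, a planar region).
[cite: DennisEtAl2002, §5.2 (a non-winding cycle is homologically trivial)] -/
private theorem mem_boundaries_of_empty_lines [NeZero L] {z : Chain L} (hz : syn L z = 0)
    (hcol : ∀ v : Vertex L, v 0 = -1 → z (v, 0) = 0)
    (hrow : ∀ v : Vertex L, v 1 = -1 → z (v, 1) = 0) : z ∈ boundaries L := by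
  obtain ⟨n, rfl⟩ : ∃ n, L = n + 1 := ⟨L - 1, (Nat.succ_pred_eq_of_ne_zero (NeZero.ne L)).symm⟩
  have hneg : ((n : ℕ) : ZMod (n + 1)) = -1 := by
    rw [eq_neg_iff_add_eq_zero, ← Nat.cast_succ, ZMod.natCast_self]
  have hcolN : ∀ k, Z0 z n k = 0 := fun k => hcol _ (by rw [vtx_apply_zero, hneg])
  have hrowN : ∀ i, Z1 z i n = 0 := fun i => hrow _ (by rw [vtx_apply_one, hneg])
  set c : Vertex (n + 1) → ZMod 2 := fun w => twoChain z n (w 0).val (w 1).val with hc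
  have hcv : ∀ j k, j ≤ n → k ≤ n → c (vtx j k) = twoChain z n j k := by
    intro j k hj hk
    simp only [hc, vtx_apply_zero, vtx_apply_one, ZMod.val_natCast,
      Nat.mod_eq_of_lt (Nat.lt_succ_of_le hj), Nat.mod_eq_of_lt (Nat.lt_succ_of_le hk)]
  refine mem_boundaries_of_twoChain c (fun u => ?_) (fun u => ?_)
  · -- horizontal link (u, 0)
    obtain ⟨j, k, hjn, hkn, hu⟩ : ∃ j k, j ≤ n ∧ k ≤ n ∧ u = vtx j k :=
      ⟨_, _, Nat.le_of_lt_succ (ZMod.val_lt (u 0)), Nat.le_of_lt_succ (ZMod.val_lt (u 1)), eq_vtx u⟩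
    subst hu
    change c (vtx j k) + c (vtx j k - dir 1) = Z0 z j k
    rcases Nat.eq_zero_or_pos k with hk0 | hkpos
    · -- k = 0: the plaquette below is in the empty row n
      subst hk0
      have e1 : (vtx j 0 : Vertex (n + 1)) - dir 1 = vtx j n := by
        rw [sub_eq_iff_eq_add, ← vtx_succ_right]
        simpa using (vtx_add_right (L := n + 1) j 0).symm
      rw [e1, hcv j 0 hjn (Nat.zero_le n), hcv j n hjn le_rfl]
      have h := twoChain_horiz hz hjn hcolN n
      have p1 : twoChain z n j (n + 1) = twoChain z n j 0 := by
        simpa using twoChain_add_right (L := n + 1) z n j 0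
      have p2 : Z0 z j (n + 1) = Z0 z j 0 := by simpa using Z0_add_right (L := n + 1) z j 0
      rw [p1, p2] at h
      have hCn : twoChain z n j n = 0 := Finset.sum_eq_zero fun i _ => hrowN _
      rw [hCn, add_zero] at h ⊢
      exact h
    · obtain ⟨k', rfl⟩ : ∃ k', k = k' + 1 := ⟨k - 1, by omega⟩
      have e1 : (vtx j (k' + 1) : Vertex (n + 1)) - dir 1 = vtx j k' := by
        rw [vtx_succ_right, add_sub_cancel_right]
      rw [e1, hcv j (k' + 1) hjn hkn, hcv j k' hjn (by omega)]
      exact twoChain_horiz hz hjn hcolN k'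
  · -- vertical link (u, 1)
    obtain ⟨j, k, hjn, hkn, hu⟩ : ∃ j k, j ≤ n ∧ k ≤ n ∧ u = vtx j k :=
      ⟨_, _, Nat.le_of_lt_succ (ZMod.val_lt (u 0)), Nat.le_of_lt_succ (ZMod.val_lt (u 1)), eq_vtx u⟩
    subst hu
    change c (vtx j k) + c (vtx j k - dir 0) = Z1 z j k
    rcases Nat.eq_zero_or_pos j with hj0 | hjpos
    · subst hj0
      have e0 : (vtx 0 k : Vertex (n + 1)) - dir 0 = vtx n k := by
        rw [sub_eq_iff_eq_add, ← vtx_succ_left]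
        simpa using (vtx_add_left (L := n + 1) 0 k).symm
      rw [e0, hcv 0 k (Nat.zero_le n) hkn, hcv n k le_rfl hkn]
      exact twoChain_vert_zero hz hrowN k
    · obtain ⟨j', rfl⟩ : ∃ j', j = j' + 1 := ⟨j - 1, by omega⟩
      have e0 : (vtx (j' + 1) k : Vertex (n + 1)) - dir 0 = vtx j' k := by
        rw [vtx_succ_left, add_sub_cancel_right]
      rw [e0, hcv (j' + 1) k hjn hkn, hcv j' k (by omega) hkn]
      exact twoChain_vert (by omega) k

/-- **A cycle of the `L × L` toric code with fewer than `L` links is a boundary.**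
[cite: DennisEtAl2002, §5.2 ("the homologically nontrivial (self-avoiding) path must contain at least L links")] -/
theorem mem_boundaries_of_hammingNorm_lt [NeZero L] {z : Chain L} (hz : z ∈ cycles L)
    (hw : hammingNorm z < L) : z ∈ boundaries L := by
  have hz' : syn L z = 0 := hz
  obtain ⟨a₀, ha₀⟩ := exists_empty_coord z hw 0
  obtain ⟨b₀, hb₀⟩ := exists_empty_coord z hw 1
  let t : Vertex L := ![a₀ + 1, b₀ + 1]
  have ht0 : t 0 = a₀ + 1 := rfl
  have ht1 : t 1 = b₀ + 1 := rfl
  have h : translate t z ∈ boundaries L := by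
    refine mem_boundaries_of_empty_lines (syn_translate_eq_zero t hz') ?_ ?_
    · intro v hv
      refine ha₀ (v + t) 0 ?_
      rw [Pi.add_apply, ht0, hv]
      ring
    · intro v hv
      refine hb₀ (v + t) 1 ?_
      rw [Pi.add_apply, ht1, hv]
      ring
  -- transport the boundary back along the translation
  change translate t z ∈ rowSpace (plaquetteMatrix L) at h
  obtain ⟨c', hc'⟩ := (mem_rowSpace_iff _ _).1 h
  refine mem_boundaries_of_translate t c' (fun u => ?_) (fun u => ?_)
  · rw [← vecMul_plaquetteMatrix_fst, hc']
  · rw [← vecMul_plaquetteMatrix_snd, hc']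

/-- **`ToricCode.cycle_weight_ge` holds**: every homologically non-trivial cycle of the `L × L`
toric code has at least `L` links (`d_Z ≥ L`). Discharges the named fact of
`ToricCodeThreshold.lean`. [cite: DennisEtAl2002, §5.2 ("At a minimum, the homologically nontrivial (self-avoiding) path must contain at least L links")] -/
theorem cycle_weight_ge_holds : cycle_weight_ge := by
  intro L _ z hz hnb
  by_contra h
  exact hnb (mem_boundaries_of_hammingNorm_lt hz (lt_of_not_ge h))

/-! ### Appended 2026-08-27 (qec-lit-2 g8): the cut-open-torus lemma with its exact hypotheses

The core lemma above only uses that ONE column carries no horizontal link of the cycle and ONE row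
carries no vertical link. This sharper form — "a cycle that does not cross some vertical dual loop
and some horizontal dual loop is homologically trivial" — is what seam-counting arguments need
(e.g. the Union-Find decoder radius, `UnionFindDecoderRadius.lean`): a homologically NON-trivial
cycle must put a horizontal link in EVERY column or a vertical link in EVERY row. -/

/-- **A cycle of the `L × L` toric code with a column free of horizontal links and a row free of
vertical links is a boundary**: if `∂z = 0`, no link `((v, 0))` with `v₀ = a₀` lies in `z` and no link
`((v, 1))` with `v₁ = b₀` lies in `z`, then `z` is homologically trivial (cut the torus open along the
dual loops through that column and that row: `z` lives on a planar region).
[cite: DennisEtAl2002, §5.2 (a cycle that does not wind around the torus is the boundary of a surface)] -/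
theorem mem_boundaries_of_emptyCol_emptyRow [NeZero L] {z : Chain L} (hz : z ∈ cycles L)
    {a₀ b₀ : ZMod L} (hcol : ∀ v : Vertex L, v 0 = a₀ → z (v, 0) = 0)
    (hrow : ∀ v : Vertex L, v 1 = b₀ → z (v, 1) = 0) : z ∈ boundaries L := by
  have hz' : syn L z = 0 := hz
  let t : Vertex L := ![a₀ + 1, b₀ + 1]
  have ht0 : t 0 = a₀ + 1 := rfl
  have ht1 : t 1 = b₀ + 1 := rfl
  have h : translate t z ∈ boundaries L := by
    refine mem_boundaries_of_empty_lines (syn_translate_eq_zero t hz') ?_ ?_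
    · intro v hv
      refine hcol (v + t) ?_
      rw [Pi.add_apply, ht0, hv]
      ring
    · intro v hv
      refine hrow (v + t) ?_
      rw [Pi.add_apply, ht1, hv]
      ring
  change translate t z ∈ rowSpace (plaquetteMatrix L) at h
  obtain ⟨c', hc'⟩ := (mem_rowSpace_iff _ _).1 h
  refine mem_boundaries_of_translate t c' (fun u => ?_) (fun u => ?_)
  · rw [← vecMul_plaquetteMatrix_fst, hc']
  · rw [← vecMul_plaquetteMatrix_snd, hc']

/-- **A homologically non-trivial cycle winds**: if `∂z = 0` and `z` is not a boundary, then either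
every column `a` contains a horizontal link of `z` (`z (v, 0) ≠ 0` for some `v` with `v₀ = a`) or every
row `b` contains a vertical link of `z` (`z (v, 1) ≠ 0` for some `v` with `v₁ = b`) — it crosses every
vertical dual loop or every horizontal dual loop. (Contrapositive of `mem_boundaries_of_emptyCol_emptyRow`.)
[cite: DennisEtAl2002, §5.2 ("the homologically nontrivial … path must … wind around the torus")] -/
theorem forall_col_or_forall_row_of_not_mem_boundaries [NeZero L] {z : Chain L} (hz : z ∈ cycles L)
    (hnb : z ∉ boundaries L) :
    (∀ a : ZMod L, ∃ v : Vertex L, v 0 = a ∧ z (v, 0) ≠ 0) ∨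
      (∀ b : ZMod L, ∃ v : Vertex L, v 1 = b ∧ z (v, 1) ≠ 0) := by
  by_contra h
  rw [not_or, not_forall, not_forall] at h
  obtain ⟨⟨a₀, ha₀⟩, ⟨b₀, hb₀⟩⟩ := h
  refine hnb (mem_boundaries_of_emptyCol_emptyRow hz (a₀ := a₀) (b₀ := b₀) ?_ ?_)
  · intro v hv
    by_contra hzv
    exact ha₀ ⟨v, hv, hzv⟩
  · intro v hv
    by_contra hzv
    exact hb₀ ⟨v, hv, hzv⟩

end ToricCode

end Literature.InformationTheory.QuantumCodes
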